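/-
Copyright (c) 2026. All rights reserved.
Released under Apache 2.0 license as described in the file LICENSE.
Authors: abc-iut cell, prover seat abc-iut-L4-d2 (gen 6).
-/
import Literature.AnabelianGeometry.AbsoluteAnabelian.GaloisTheatersNumberFieldShadowTPairsCor52iii
import Literature.AnabelianGeometry.AbsoluteAnabelian.GaloisTheatersNumberFieldShadowRmk511
import Literature.AnabelianGeometry.AbsoluteAnabelian.TPairsCor52Conditional
import HarnessLib

/-!
# [AbsTopIII] Cor 5.2 (iv) (F-0192 `TPairIsoCanonical`, F-0190 `TPairEAHomExtends`) PROVED at the shadow `TM`-vocabulary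

S. Mochizuki, *Topics in absolute anabelian geometry III* [MochizukiAbsTopIII2015], Cor 5.2 (iv) p. 120: the functors
`EA⊚ → An⊚[Th⊚_T] → Th⊚_T` are equivalences — every global `T`-pair is isomorphic over `𝟙_Π` to the canonical one
(`TPairIsoCanonical`, F-0192) and every morphism of `EA⊚` extends to a morphism of canonical global `T`-pairs
(`TPairEAHomExtends`, F-0190).  Both are NAMED FACTS over `(R, W)` (`TPairs.lean`; universal closures refuted,
`TPairsSchemaNegative.lean`); F-0192 was reduced by abc-iut-L4-t3 lineage (`tPairIsoCanonical_of_descent`,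
`TPairsCor52Conditional.lean`) to `k_NF(𝟙) = id` + three descent laws of the vocabulary's predicates.

THIS PROOF-ONLY FILE proves both at `(R, W) := (NumberFieldShadow.context F, shadowVocabulary F)`
(`GaloisTheatersNumberFieldShadowTPairs.lean`, abc-iut-L4-d2 g6; `T = TM`, `M_{TLG}(Π) = ℚ̄ˣ` through the `ℚ`-chart):

* `isContGlob_descends_shadow`, `isMLFGaloisPair_descends_shadow` — open stabilisers descend along equivariant
  isomorphisms; "the group is of MLF-Galois type" descends along `D ≃ₜ* D'`;
  **`tPairIsoCanonical_shadow : TPairIsoCanonical (shadowVocabulary F) tm_ne_tlg`** (F-0192);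
* **`tPairEAHomExtends_shadow : TPairEAHomExtends (shadowVocabulary F) tm_ne_tlg`** (F-0190) — over a morphism
  `f : Π₁ ↪ Π₂` of `EA⊚` between admissible objects: the theater part is `eaHomExtendsToTheaters_context` (Cor 5.2 (i)),
  `φ⊚ = φ_v :=` the action of the conjugator `τ_f` on `ℚ̄ˣ` (equivariance = the chart-transition law), `ρ := 𝟙`,
  Kummer clause trivial at the stubs.

NOT addressed (honest): F-0189 `ReferencePairIsoUnique` / F-0191 `TPairHomDeterminedByTheaterHom` — their reduction
(`…_of_rigid`) needs the rigidity law (L) "an automorphism of an MLF-Galois `T`-pair commuting with the action is the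
identity", FALSE for the group-only local data `ℚ̄ˣ` of this vocabulary (inversion commutes with the Galois action);
print's (L) lives on `𝒪^▷`/field structure (`T = TM/TF` genuinely).  HONEST LABEL: shadow vocabulary (`Δ = 1`, genuine
global Galois data, stub local/archimedean/cyclotomic structure), NOT print's `T`-pairs of a curve (E-L4-13); classical;
nothing here bears on [IUTchIII] Cor. 3.12 or takes a side.
-/

noncomputable section

open scoped Pointwise Topology
open CategoryTheory NumberField Field

namespace Literature.AnabelianGeometry.AbsoluteAnabelian

namespace NumberFieldShadow

variable (F : Type) [Field F] [NumberField F]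

/-! ### The descent laws at the shadow vocabulary -/

/-- Open stabilisers DESCEND along an equivariant isomorphism of `T⊚`-objects (the continuity predicate of the shadow
vocabulary). [cite: MochizukiAbsTopIII2015, Def 5.1 (v) p.117] -/
theorem isContGlob_descends_shadow {G : ProfiniteGrp.{0}} {M N : (shadowVocabulary F).GlobObj}
    (a : G →* Aut M) (b : G →* Aut N) (ψ : M ≅ N) (h : ∀ g, (a g).hom ≫ ψ.hom = ψ.hom ≫ (b g).hom)
    (hb : (shadowVocabulary F).IsContGlob b) : (shadowVocabulary F).IsContGlob a := by
  intro m
  obtain ⟨U, hU⟩ := hb (ψ.hom.hom m)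
  refine ⟨U, fun u hu => ?_⟩
  have hinj : Function.Injective ψ.hom.hom :=
    (ψ.commGroupIsoToMulEquiv : (show CommGrpCat.{0} from M) ≃* (show CommGrpCat.{0} from N)).injective
  apply hinj
  have := congrArg (fun φ : M ⟶ N => φ.hom m) (h u)
  change ψ.hom.hom ((a u).hom.hom m) = (b u).hom.hom (ψ.hom.hom m) at this
  exact this.trans (hU u hu)

/-- "The group is of MLF-Galois type" DESCENDS along isomorphisms of topological groups (the MLF-Galois-pair predicate of
the shadow vocabulary). [cite: MochizukiAbsTopIII2015, Def 5.1 (v) p.117] -/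
theorem isMLFGaloisPair_descends_shadow {D D' : ProfiniteGrp.{0}} {M N : (shadowVocabulary F).LocObj}
    (a : D →* Aut M) (b : D' →* Aut N) (e : D ≃ₜ* D') (ψ : M ≅ N)
    (_h : ∀ g, (a g).hom ≫ ψ.hom = ψ.hom ≫ (b (e g)).hom)
    (hb : (shadowVocabulary F).IsMLFGaloisPair b) : (shadowVocabulary F).IsMLFGaloisPair a :=
  IsMLFGaloisType.of_continuousMulEquiv hb e

/-! ### F-0192: every global `TM`-pair is isomorphic to the canonical one -/

/-- **Cor 5.2 (iv), essential surjectivity (F-0192), PROVED at the shadow `TM`-vocabulary**: every global `TM`-pair over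
the shadow is isomorphic over `𝟙_Π` to the canonical pair `M⊚_TM(Π)`. [cite: MochizukiAbsTopIII2015, Cor 5.2 (iv) p.120] -/
theorem tPairIsoCanonical_shadow : TPairIsoCanonical (shadowVocabulary F) tm_ne_tlg :=
  (shadowVocabulary F).tPairIsoCanonical_of_descent tm_ne_tlg (context_mapKNF_id F)
    (fun a b ψ h hb => isContGlob_descends_shadow F a b ψ h hb)
    (fun a b e ψ h hb => isMLFGaloisPair_descends_shadow F a b e ψ h hb)
    (fun _ _ _ _ => trivial)

/-! ### F-0190: morphisms of `EA⊚` extend to the canonical global `TM`-pairs -/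

/-- The action of the conjugator `τ_f` on `ℚ̄ˣ` intertwines the chart actions of `Π₁` and `Π₂` (the chart-transition law,
multiplicative units). [cite: MochizukiAbsTopIII2015, Def 5.1 (iii) p.115] -/
theorem conjugator_smul_units {E₁ E₂ : FundamentalExtension.{0}} (f : E₁ ⟶ E₂) (hf : IsEAHom f) (g : E₁.arith)
    (x : (AlgebraicClosure ℚ)ˣ) :
    conjugator f hf • (ratChart E₁ g • x) = ratChart E₂ (f.arith g) • (conjugator f hf • x) := by
  rw [ratChart_comp_eq_conj f hf g, mul_smul, mul_smul, inv_smul_smul]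

/-- **Cor 5.2 (iv), full faithfulness (F-0190), PROVED at the shadow `TM`-vocabulary**: every morphism of `EA⊚` between
admissible `Π₁, Π₂` extends to a morphism of the canonical global `TM`-pairs (theater part: Cor 5.2 (i) at the shadow;
`φ⊚ = φ_v :=` the conjugator acting on `ℚ̄ˣ`). [cite: MochizukiAbsTopIII2015, Cor 5.2 (iv) p.120] -/
theorem tPairEAHomExtends_shadow : TPairEAHomExtends (shadowVocabulary F) tm_ne_tlg := by
  intro E₁ E₂ h₁ h₂ hc₁ hM₁ hA₁ hc₂ hM₂ hA₂ f hf
  obtain ⟨φV, hφV⟩ := eaHomExtendsToTheaters_context F E₁ E₂ h₁ h₂ f hf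
  subst hφV
  let τ : absoluteGaloisGroup ℚ := conjugator φV.φgrp hf
  let φM : (CommGrpCat.of (AlgebraicClosure ℚ)ˣ : CommGrpCat.{0}) ≅ CommGrpCat.of (AlgebraicClosure ℚ)ˣ :=
    unitsAutHom τ
  have hφM : ∀ x : (AlgebraicClosure ℚ)ˣ, φM.hom.hom x = τ • x := fun _ => rfl
  have non_mem : ∀ v : ((context F).theater E₁ h₁).V.non, φV.φV v ∈ ((context F).theater E₂ h₂).V.non := by
    intro v
    have h : φV.φV v ∈ φV.φV '' ((context F).theater E₁ h₁).V.non := ⟨v, v.2, rfl⟩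
    rw [φV.image_non] at h
    exact h
  have arc_mem : ∀ v : ((context F).theater E₁ h₁).V.arc, φV.φV v ∈ ((context F).theater E₂ h₂).V.arc := by
    intro v
    have h : φV.φV v ∈ φV.φV '' ((context F).theater E₁ h₁).V.arc := ⟨v, v.2, rfl⟩
    rw [φV.image_arc] at h
    exact h
  refine ⟨{ φV := φV
            φM := φM
            φM_equivariant := fun g => ?_
            non_mem := non_mem
            arc_mem := arc_mem
            φnon := fun _ => φM
            φnon_equivariant := fun v g hg hg' => ?_
            φarc := fun _ => φM
            φarc_kummer := fun v => ?_
            ρnon_comm := fun v => ?_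
            ρarc_comm := fun v => ?_ }, rfl⟩
  · change (shadowGlobAct E₁ g).hom ≫ φM.hom = φM.hom ≫ (shadowGlobAct E₂ (φV.φgrp.arith g)).hom
    ext x : 2
    change φM.hom.hom (ratChart E₁ g • x) = ratChart E₂ (φV.φgrp.arith g) • φM.hom.hom x
    rw [hφM, hφM]
    exact conjugator_smul_units φV.φgrp hf g x
  · change (shadowGlobAct E₁ g).hom ≫ φM.hom = φM.hom ≫ (shadowGlobAct E₂ (φV.φgrp.arith g)).hom
    ext x : 2
    change φM.hom.hom (ratChart E₁ g • x) = ratChart E₂ (φV.φgrp.arith g) • φM.hom.hom x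
    rw [hφM, hφM]
    exact conjugator_smul_units φV.φgrp hf g x
  · obtain ⟨φv, -, hinner, hκ⟩ := φV.arch_compat v (arc_mem v)
    exact ⟨φv, hinner, hκ, rfl⟩
  · change 𝟙 _ ≫ (𝟭 CommGrpCat.{0}).map φM.hom = φM.hom ≫ 𝟙 _
    rw [Functor.id_map, Category.id_comp, Category.comp_id]
  · change 𝟙 _ ≫ (𝟭 CommGrpCat.{0}).map φM.hom = φM.hom ≫ 𝟙 _
    rw [Functor.id_map, Category.id_comp, Category.comp_id]

end NumberFieldShadow

end Literature.AnabelianGeometry.AbsoluteAnabelian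

end
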